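import Summits.Ventures.AbcShadow.SH04.BVY04PackageDvdAB
import Summits.Ventures.AbcShadow.SH04.LStar

/-!
# Venture AbcShadow — the [BVY04] package AS AMENDED (two-signed `S_q`): allowed-set-parametric forms of the named hypotheses

HONEST FRAMING. Interface file of the work-bound cell `abc-shadow` (typer seat `abc-shadow-typ-1`, lineage g3). NOTHING here is a theorem
about a Diophantine equation; nothing here is a claim on abc or on any summit; no side on IUT. WHY THIS FILE: the cell's critic found a PRINT
ERRATUM in [BVY04] (crit-1 g3, 2026-08-28T22:57:25Z, memo `pub/abc-shadow/crit-1-SH04-5911.md` sha16 812d2f7844b0b019 §2): in [Lemma 2.1 (ii)]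
the mod-21 split/non-split rule for the multiplicative primes `p ∣ a` has a sign slip (the reduced Frey curve `y² + 3u·xy + u³y = x³` is split
multiplicative iff `p ≡ 1 (mod 3)`, not by the printed mod-21 classes; checked by point counts at all primes `5 ≤ p < 200`), so the ONE-SIGNED
printed shape of [Prop 4.2]'s admissible set `S_q` (`bvy04AllowedPrint`: only `+(q+1)` at `q ≡ 1, 4, 5, 7, 16, 17, 20 (mod 21)`) OMITS the
genuine trace `−(q+1)` at `q ≡ 5, 17, 20 (mod 21)`. The TWO-SIGNED union `bvy04Allowed` ("variant B" of the cell's certificate: `±(q+1)` at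
every `q`) is what modularity + level lowering actually deliver. g0's `CMNewformModel.BVY04Package` is print-faithful (one-signed) and hence,
as a hypothesis, STRONGER than what is known to hold; the critic's action item for this lineage: «restate the package with `bvy04Allowed` and
re-point the rows» — every kernel certificate of this lineage was already built for variant B (the level files say so; the critic re-checked it
at level 351, `W351B.lean` 16eac8d366522946). THIS FILE makes the allowed-set function a PARAMETER `A` of the three named hypotheses, so that
the amended (two-signed) rows are literally the instances `A := bvy04Allowed`, and the print-faithful ones the instances `A := bvy04AllowedPrint`:

* `CMNewformModel.BVY04PackageA A` — g0's `BVY04Package` with the conclusion `ArisesMod f n A` (binder list byte-identical otherwise);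
  `bvy04PackageA_print_iff : M.BVY04PackageA bvy04AllowedPrint ↔ M.BVY04Package` (`Iff.rfl`), `bvy04PackageA_mono` (larger `A` = weaker
  hypothesis), hence `bvy04PackageB_of_print : M.BVY04Package → M.BVY04PackageA bvy04Allowed` — the AMENDED package asks LESS than print's.
* `CMNewformModel.BVY04PackageDvdABA A` — the same for the branch `n ∣ AB` of [Lemma 3.4] (`SH04/BVY04PackageDvdAB.lean`, pair `(61,61)`).
* `CMNewformModel.LStarTransferA A N o n r N' D` — the L\* transfer (`SH04/LStar.lean`) with the congruence guard `MatchesModAt … A r`;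
  `lStarTransferA_print_iff` (`Iff.rfl`). Its truth in the intended model does not depend on `A` (critic's read 23:05:17Z: FAITHFUL); with a
  LARGER `A` the guard is weaker, so `LStarTransferA bvy04Allowed …` is formally the stronger assumption — recorded, not hidden.

The amended rows are `SH04/PairRowA.lean`, `SH04/PairRow17A.lean` (generic in `A`) and the `…B` instance files. References: [BVY04]
Bennett–Vatsal–Yazdani, Compositio Math. 140 (2004), Lemma 2.1 p.1401–1402, Prop 4.2 pp.1406–1407; the cell's erratum memo as above.
AI-typed; weaker than expert refereeing.
-/

namespace Summit.Ventures.AbcShadow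

open Summit.Ventures.AbcSig (NewformModel FreyDatum OrbitData)

/-- **NAMED HYPOTHESIS [BVY04, Lemma 3.4 + Cor 3.3 + Prop 4.2], allowed-set-parametric** — g0's `BVY04Package` VERBATIM except that the
[Prop 4.2] congruences are demanded with traces in `A q` instead of print's one-signed `S_q`: `A := bvy04AllowedPrint` is print as stated,
`A := bvy04Allowed` (two-signed, `±(q+1)` at every `q`) is the package AS AMENDED after the cell's erratum on [Lemma 2.1 (ii)] (module docstring).
CITED (+ the cell's erratum for the choice of `A`), never proved here.
[cite: BennettVatsalYazdani2004, Lemma 3.4 p.1406; Cor 3.3 p.1405; Prop 4.2 pp.1406-1407 (admissible set, two shapes); Lemma 2.1 (ii) p.1401 (erratum: two-signed)] -/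
def CMNewformModel.BVY04PackageA (M : CMNewformModel) (A : ℕ → List ℤ) : Prop :=
  ∀ (S : FreyDatum) (κ : BVYCase),
    0 < S.A → 0 < S.B → 0 < S.C →
    (∀ q : ℕ, q.Prime → ¬ q ^ 3 ∣ S.C) →
    (∀ q : ℕ, q.Prime → ¬ q ^ S.n ∣ S.A ∧ ¬ q ^ S.n ∣ S.B) →
    S.n.Prime → 5 ≤ S.n → ¬ S.n ∣ S.A * S.B * S.C →
    ¬ (3 : ℤ) ∣ (S.A : ℤ) * S.a → ¬ (3 : ℤ) ∣ (S.B : ℤ) * S.b ^ S.n - 2 →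
    IsPrimitiveSolution S.A S.B S.C S.n S.a S.b S.c → S.a * S.b ≠ 1 → S.a * S.b ≠ -1 →
    ¬ (S.A * S.B = 27 ∧ S.n = 5) → ¬ (S.A * S.B = 3 ∧ S.n = 7) →
    κ.Holds S.A S.B S.C S.n S.a S.b S.c →
    ∀ N : ℕ, bvy04Level κ S.A S.B S.C = N →
      (∃ f : M.Form N, M.Arises S N f) ∧
      (∀ f : M.Form N, M.Arises S N f → M.ArisesMod f S.n A)

/-- At `A := bvy04AllowedPrint` the parametric package IS g0's `BVY04Package` (definitionally). [cite: BennettVatsalYazdani2004, Prop 4.2 pp.1406-1407] -/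
theorem bvy04PackageA_print_iff (M : CMNewformModel) : M.BVY04PackageA bvy04AllowedPrint ↔ M.BVY04Package := Iff.rfl

/-- Monotonicity: enlarging every allowed set WEAKENS the package hypothesis (its conclusion `ArisesMod f n A` is monotone in `A`). [folklore] -/
theorem bvy04PackageA_mono (M : CMNewformModel) {A A' : ℕ → List ℤ} (hAA' : ∀ ℓ : ℕ, ∀ t ∈ A ℓ, t ∈ A' ℓ)
    (h : M.BVY04PackageA A) : M.BVY04PackageA A' := by
  intro S κ hA hB hC hcf hpf hn h5 hnABC h3a h3b hsol hab1 hab2 he1 he2 hκ N hN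
  obtain ⟨hex, hmod⟩ := h S κ hA hB hC hcf hpf hn h5 hnABC h3a h3b hsol hab1 hab2 he1 he2 hκ N hN
  exact ⟨hex, fun f hf => arisesMod_mono M.toNewformModel f S.n A A' hAA' (hmod f hf)⟩

/-- **Print's package implies the AMENDED (two-signed) one**: `BVY04Package → BVY04PackageA bvy04Allowed` (`S_q ⊆` its two-signed union), i.e.
the amended rows ASK LESS than the print-faithful ones. [cite: BennettVatsalYazdani2004, Prop 4.2 pp.1406-1407 (both printed shapes ⊆ the two-signed union)] -/
theorem bvy04PackageB_of_print (M : CMNewformModel) (h : M.BVY04Package) : M.BVY04PackageA bvy04Allowed :=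
  bvy04PackageA_mono M bvy04AllowedPrint_subset ((bvy04PackageA_print_iff M).mpr h)

/-- **NAMED HYPOTHESIS [BVY04, Lemma 3.4 (branch `n ∣ AB`) + Cor 3.3 + Prop 4.2], allowed-set-parametric** — `BVY04PackageDvdAB`
(`SH04/BVY04PackageDvdAB.lean`, with its ONE flagged reading of the level) VERBATIM except for the allowed-set function `A` in the conclusion.
Used only by the pair `(61, 61)`. CITED + one reading (+ the erratum for the choice of `A`), never proved here.
[cite: BennettVatsalYazdani2004, Lemma 3.4 p.1406 (branch n ∣ AB); Cor 3.3 p.1405; Prop 4.2 pp.1406-1407] -/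
def CMNewformModel.BVY04PackageDvdABA (M : CMNewformModel) (A : ℕ → List ℤ) : Prop :=
  ∀ (S : FreyDatum) (κ : BVYCase),
    0 < S.A → 0 < S.B → 0 < S.C →
    (∀ q : ℕ, q.Prime → ¬ q ^ 3 ∣ S.C) →
    (∀ q : ℕ, q.Prime → ¬ q ^ S.n ∣ S.A ∧ ¬ q ^ S.n ∣ S.B) →
    S.n.Prime → 5 ≤ S.n → S.n ∣ S.A * S.B →
    ¬ (3 : ℤ) ∣ (S.A : ℤ) * S.a → ¬ (3 : ℤ) ∣ (S.B : ℤ) * S.b ^ S.n - 2 →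
    IsPrimitiveSolution S.A S.B S.C S.n S.a S.b S.c → S.a * S.b ≠ 1 → S.a * S.b ≠ -1 →
    ¬ (S.A * S.B = 27 ∧ S.n = 5) → ¬ (S.A * S.B = 3 ∧ S.n = 7) →
    κ.Holds S.A S.B S.C S.n S.a S.b S.c →
    ∀ N : ℕ, bvy04Level κ S.A S.B S.C = N →
      (∃ f : M.Form N, M.Arises S N f) ∧
      (∀ f : M.Form N, M.Arises S N f → M.ArisesMod f S.n A)

/-- At `A := bvy04AllowedPrint` this is `BVY04PackageDvdAB` (definitionally). [cite: BennettVatsalYazdani2004, Lemma 3.4 p.1406 (branch n ∣ AB)] -/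
theorem bvy04PackageDvdABA_print_iff (M : CMNewformModel) :
    M.BVY04PackageDvdABA bvy04AllowedPrint ↔ M.BVY04PackageDvdAB := Iff.rfl

/-- Print-form ⇒ amended form for the `n ∣ AB` package as well. [cite: BennettVatsalYazdani2004, Prop 4.2 pp.1406-1407 (both printed shapes ⊆ the two-signed union)] -/
theorem bvy04PackageDvdABB_of_print (M : CMNewformModel) (h : M.BVY04PackageDvdAB) : M.BVY04PackageDvdABA bvy04Allowed := by
  intro S κ hA hB hC hcf hpf hn h5 hnAB h3a h3b hsol hab1 hab2 he1 he2 hκ N hN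
  obtain ⟨hex, hmod⟩ := h S κ hA hB hC hcf hpf hn h5 hnAB h3a h3b hsol hab1 hab2 he1 he2 hκ N hN
  exact ⟨hex, fun f hf => arisesMod_mono M.toNewformModel f S.n bvy04AllowedPrint bvy04Allowed bvy04AllowedPrint_subset (hmod f hf)⟩

/-- **NAMED HYPOTHESIS — the L\* congruence transfer, allowed-set-parametric**: `LStarTransfer` of `SH04/LStar.lean` VERBATIM except that the
guard reads `MatchesModAt … A r` ("the [Prop 4.2] congruences with traces in `A` hold modulo the prime through which `θ ≡ r`"). Content and
nature as there (COMPUTED Sturm-bound congruence + CITED transfer; the cell's lemma-level input L\*, critic's faithfulness read 23:05:17Z). Note: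
a larger `A` makes the guard weaker and the hypothesis formally stronger; its truth in the intended model does not depend on `A`.
[cite: BennettVatsalYazdani2004, Lemma 3.1 p.1404; p.1405 (arises from); Prop 4.3 p.1407 (the CM hypothesis it feeds)] -/
def CMNewformModel.LStarTransferA (M : CMNewformModel) (A : ℕ → List ℤ) (N : ℕ) (o : OrbitData) (n : ℕ) (r : ℤ) (N' : ℕ)
    (D : ℤ) : Prop :=
  ∀ S : FreyDatum, S.n = n → IsPrimitiveSolution S.A S.B S.C S.n S.a S.b S.c → S.a * S.b ≠ 1 → S.a * S.b ≠ -1 →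
    ∀ f : M.Form N, M.Arises S N f → MatchesModAt M.toNewformModel f o n A r →
      ∃ g : M.Form N', M.HasCM N' g D ∧ M.Arises S N' g

/-- At `A := bvy04AllowedPrint` this is `LStarTransfer` (definitionally). [cite: BennettVatsalYazdani2004, p.1405 (arises from)] -/
theorem lStarTransferA_print_iff (M : CMNewformModel) (N : ℕ) (o : OrbitData) (n : ℕ) (r : ℤ) (N' : ℕ) (D : ℤ) :
    M.LStarTransferA bvy04AllowedPrint N o n r N' D ↔ M.LStarTransfer N o n r N' D := Iff.rfl

end Summit.Ventures.AbcShadow
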